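import Summits.AnomalousDissipation.AnomalousDissipation.Theorems.SawtoothPulseCascadeK1LocalisedCascadeWindowBlockV
import Summits.AnomalousDissipation.AnomalousDissipation.Theorems.SawtoothPulseCascadeK1LocalisedCascadeTrapezoidLog

/-!
# K1loc, line `Spectral` / thin start — helper: THE GENERAL-WINDOW V HALF-STEP WITH THE SHARP KERNEL CONSTANTS (log-L¹, tail 1/(2Dδ))

Helper file of the prover lane on the crux `K1LocalisedCascade` (stmt-AnomalousDissipation-19491), route
`SawtoothPulseCascade` (S-D fibre ledger; memo v12 §14 lever (1)).  Identical to `…WindowBlockV.sum_windowBlock_vstep_le` except that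
the two kernel estimates of the maximal-ramp trapezoids `ψ_n = (p(n), |n|γ)` are the SHARP ones of `…TrapezoidLog` /
`…TrapezoidTail` (p3 g3): `∫|k_{ψ_n}| ≤ 4/π + (2/π)·log((p+|n|γ)/(|n|γ−p)) + 1/D_n + 1/(πD_n²)` (`D_n = |n|γ − p(n)`) and
`∫_{δ≤‖s‖}|k_{ψ_n}| ≤ (1/(2D_n))/δ`.  So the per-fibre hypotheses become
`hA : 4/π + (2/π)·log((p+|n|γ)/(|n|γ−p)) + 1/D_n + 1/(πD_n²) ≤ A` and `hτ : 1/(2D_n) ≤ τ` on the fibres of `W`: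
**`sum_windowBlock_vstep_le_log`** — same conclusion
`Σ_{k∈W}‖𝓕(b∘Φ_V)(k)‖² ≤ (((Q₁+Q₂)/(Q₂−Q₁))·(ε₀ + A√(2N_j·4d₀)) + √(Σ' k, [Λ ≤ |k₁| ≤ Λ' ∧ Q₁ < |k₀|]‖𝓕b(k)‖²))²`.
(The input trapezoid `χ` keeps the ratio bound here; its log form is the same one-line change.)  No definitions; no statement
about the crux. [cite: Grafakos2014, Prop. 3.1.2 (5), Prop. 3.2.7 (3), §3.1.3] [cite: ElgindiLissMattingly2025, §1 (slope ±1 branches)]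
[problem: turb]
-/

-- `Summit.<Summit>.<Problem>`: single-conjunct summit, the duplicate namespace segment is deliberate.
set_option linter.dupNamespace false

noncomputable section

namespace Summit.AnomalousDissipation.AnomalousDissipation.Theorems.SawtoothPulseCascade.K1Window

open MeasureTheory Set Filter Topology UnitAddTorus Function Complex Metric
open scoped Real ENNReal
open Literature.Analysis Literature.Analysis.FunctionSpaces Literature.Analysis.FunctionSpaces.Torus Literature.Analysis.FluidPDE
open Literature.Analysis.FluidPDE.ShearStage
open Literature.Analysis.FluidPDE.SawtoothCascade Literature.Analysis.FluidPDE.SawtoothCascade.CascadeParams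
open Summit.AnomalousDissipation.AnomalousDissipation.Theorems.SawtoothPulseCascade.K1Start
open Summit.AnomalousDissipation.AnomalousDissipation.Theorems.SawtoothPulseCascade.K1Flat

/-! ## The V half-step on a fibre block, sharp kernel constants -/

/-- **THE V HALF-STEP ON A FIBRE BLOCK, GENERAL WINDOW, SHARP KERNEL CONSTANTS** (see the file header).
[cite: Grafakos2014, Prop. 3.1.2 (5), Prop. 3.2.7 (3), §3.1.3] -/
theorem sum_windowBlock_vstep_le_log (P : CascadeParams) {G : ℕ} (hγ : P.γ = G) (hδ₀ : 0 < P.δ₀) (hd : 0 < P.d)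
    (hN₀ : 1 ≤ P.N₀) (hρN : 1 ≤ P.ρN) (j : ℕ)
    {b : UnitAddTorus (Fin 2) → ℂ} (hb : Continuous b) (hbs : Summable fun k => ‖mFourierCoeff b k‖) (hb1 : ∀ x, ‖b x‖ ≤ 1)
    {Q₁ Q₂ Λ Λ' : ℕ} (hQ : Q₁ < Q₂) (p : ℤ → ℕ)
    (W : Finset (Fin 2 → ℤ)) (hW : ∀ k ∈ W, (Λ : ℤ) ≤ |k 1| ∧ |k 1| ≤ Λ')
    (hWp : ∀ k ∈ W, |k 0| + Q₂ ≤ (p (k 1) : ℤ)) (hpG : ∀ k ∈ W, p (k 1) < (k 1).natAbs * G)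
    {d₀ M ε₀ A τ : ℝ} (hd₀ : 0 < d₀) (hM : 1 ≤ M) (hMδ : M * P.δ j < π / 2) (hMd : M * P.δ j < π * P.N j * d₀)
    (hA0 : 0 ≤ A) (hA : ∀ k ∈ W, 4 / π + 2 / π * Real.log ((((p (k 1) : ℝ) + ((k 1).natAbs * G : ℕ)) /
        ((((k 1).natAbs * G : ℕ) : ℝ) - p (k 1)))) + 1 / ((((k 1).natAbs * G : ℕ) : ℝ) - p (k 1)) +
        1 / (π * (((((k 1).natAbs * G : ℕ) : ℝ) - p (k 1))) ^ 2) ≤ A)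
    (hτ : ∀ k ∈ W, 1 / (2 * ((((k 1).natAbs * G : ℕ) : ℝ) - p (k 1))) ≤ τ)
    (hAd : 8 * τ ≤ A * d₀) (hε0 : 0 ≤ ε₀)
    (hε : A * (2 * π * ((Λ' * G : ℕ) : ℝ) * (Real.exp (-(M ^ 2 / 2)) / (2 * P.N j))) ≤ ε₀) :
    ∑ k ∈ W, ‖mFourierCoeff (b ∘ shearMap 1 0 (amp ⟨P.U j, P.U_periodic j, P.contDiff_U (P.δ_pos hδ₀ hd j)⟩ P.γ)) k‖ ^ 2 ≤
      ((((Q₁ : ℝ) + Q₂) / ((Q₂ : ℝ) - Q₁)) * (ε₀ + A * Real.sqrt ((2 * P.N j : ℕ) * (4 * d₀))) +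
        Real.sqrt (∑' k : Fin 2 → ℤ, (if (Λ : ℤ) ≤ |k 1| ∧ |k 1| ≤ Λ' ∧ (Q₁ : ℤ) < |k 0| then (1 : ℝ) else 0) *
          ‖mFourierCoeff b k‖ ^ 2)) ^ 2 := by
  classical
  -- the data of `…HalfStepVT`
  set χ : ℤ → ℂ := fun m => ((min 1 (max 0 (((Q₂ : ℝ) - |(m : ℝ)|) / ((Q₂ : ℝ) - Q₁))) : ℝ) : ℂ) with hχdef
  have hχ : ∀ m : ℤ, χ m = ((min 1 (max 0 (((Q₂ : ℝ) - |(m : ℝ)|) / ((Q₂ : ℝ) - Q₁))) : ℝ) : ℂ) := fun m => rfl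
  set ψ : ℤ → ℤ → ℂ := fun n m => if p n < n.natAbs * G then
      ((min 1 (max 0 ((((n.natAbs * G : ℕ) : ℝ) - |(m : ℝ)|) / (((n.natAbs * G : ℕ) : ℝ) - p n))) : ℝ) : ℂ) else 0 with hψdef
  set Sψ : ℤ → Finset ℤ := fun n => Finset.Icc (-((n.natAbs * G : ℕ) : ℤ)) (n.natAbs * G : ℕ) with hSψ
  -- fibres of the window and the trapezoid facts on them
  have hnat : ∀ k ∈ W, Λ ≤ (k 1).natAbs ∧ (k 1).natAbs ≤ Λ' := fun k hk => by
    obtain ⟨h2, h3⟩ := hW k hk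
    rw [← Int.natCast_natAbs] at h2 h3
    exact ⟨by exact_mod_cast h2, by exact_mod_cast h3⟩
  have hfib : ∀ k ∈ W, p (k 1) < (k 1).natAbs * G := hpG
  have hψk : ∀ k ∈ W, ∀ m : ℤ, ψ (k 1) m =
      ((min 1 (max 0 (((((k 1).natAbs * G : ℕ) : ℝ) - |(m : ℝ)|) / ((((k 1).natAbs * G : ℕ) : ℝ) - p (k 1)))) : ℝ) : ℂ) :=
    fun k hk m => by simp only [hψdef, if_pos (hfib k hk)]
  have hnG : ∀ n : ℤ, ((n.natAbs * G : ℕ) : ℤ) = |n * G| := fun n => by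
    rw [abs_mul, Nat.cast_mul, Int.natCast_natAbs, abs_of_nonneg (Int.natCast_nonneg G)]
  -- the hypotheses of the abstract half-step
  have hχS : ∀ l, l ∉ Finset.Icc (-(Q₂ : ℤ)) Q₂ → χ l = 0 := trapezoid_support hQ hχ
  have hχ1 : ∀ l, ‖χ l‖ ≤ 1 := fun l => (trapezoid_values hQ hχ l).2.2
  have hχL : ∀ l, χ l ≠ 0 → |l| < (Q₂ : ℤ) := fun l hl => by
    by_contra h; push Not at h; exact hl ((trapezoid_values hQ hχ l).2.1 h)
  have hψS : ∀ n m, m ∉ Sψ n → ψ n m = 0 := by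
    intro n m hm
    by_cases hn : p n < n.natAbs * G
    · have := trapezoid_support hn (χ := ψ n) (fun m' => by simp only [hψdef, if_pos hn]) m hm
      exact this
    · simp only [hψdef, if_neg hn]
  have hψ0 : ∀ k ∈ W, ψ (k 1) (k 1 * G) = 0 ∧ ψ (k 1) (-(k 1 * G)) = 0 := by
    intro k hk
    have hv := fun m => trapezoid_values (hfib k hk) (hψk k hk) m
    refine ⟨(hv _).2.1 ?_, (hv _).2.1 ?_⟩
    · rw [hnG]
    · rw [hnG, abs_neg]
  have hψ1 : ∀ k ∈ W, ∀ l : ℤ, |l| < (Q₂ : ℤ) → ψ (k 1) (k 0 - l) = 1 := by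
    intro k hk l hl
    refine (trapezoid_values (hfib k hk) (hψk k hk) _).1 ?_
    have h0 := hWp k hk
    have : |k 0 - l| ≤ |k 0| + |l| := abs_sub _ _
    linarith
  have hA' : ∀ k ∈ W, (∫ s : UnitAddCircle, ‖∑ m ∈ Sψ (k 1), ψ (k 1) m * fourier (-m) s‖) ≤ A := fun k hk =>
    (integral_norm_trapezoidKernel_le_log (hfib k hk) (hψk k hk)).trans (hA k hk)
  have hτ' : ∀ k ∈ W, ∀ δ : ℝ, 0 < δ →
      ∫ s in {s : UnitAddCircle | δ ≤ ‖s‖}, ‖∑ m ∈ Sψ (k 1), ψ (k 1) m * fourier (-m) s‖ ≤ τ / δ := by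
    intro k hk δ hδ
    refine (setIntegral_norm_trapezoidKernel_le_div (hfib k hk) (hψk k hk) hδ).trans ?_
    exact div_le_div_of_nonneg_right (hτ k hk) hδ.le
  have hAd' : 8 * τ ≤ A * d₀ := hAd
  have hε' : ∀ k ∈ W, A * (2 * π * |((k 1 * G : ℤ) : ℝ)| * (Real.exp (-(M ^ 2 / 2)) / (2 * P.N j))) ≤ ε₀ := by
    intro k hk
    refine le_trans (mul_le_mul_of_nonneg_left (mul_le_mul_of_nonneg_right
      (mul_le_mul_of_nonneg_left ?_ (by positivity)) (by positivity)) hA0) hε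
    rw [← Int.cast_abs, ← hnG]
    exact_mod_cast Nat.mul_le_mul_right _ (hnat k hk).2
  -- the abstract half-step
  have hmain := sum_window_sq_norm_vstep_twist_le P hγ hδ₀ hd hN₀ hρN j hb hbs hb1 W χ _ hχS hχ1 Q₂ hχL ψ Sψ hψS hψ0 hψ1
    hd₀ hM hMδ hMd hA0 hA' hτ' hAd' hε0 hε'
  refine hmain.trans (pow_le_pow_left₀ (by positivity) (add_le_add ?_ (Real.sqrt_le_sqrt ?_)) 2)
  · -- kernel `L¹` norm of the input trapezoid
    have hK := integral_norm_trapezoidKernel_le_ratio hQ hχ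
    have hS0 : 0 ≤ ε₀ + A * Real.sqrt ((2 * P.N j : ℕ) * (4 * d₀)) := by positivity
    exact mul_le_mul_of_nonneg_right hK hS0
  · -- the pass-through term as a spectral class
    refine sum_passThrough_le_tsum hb hχS (fun l => ?_) (fun l hl => (trapezoid_values hQ hχ l).1 hl) _
      (fun n hn => ?_)
    · exact ⟨_, (clamp_facts (((Q₂ : ℝ) - |(l : ℝ)|) / ((Q₂ : ℝ) - Q₁)) 0).1,
        (clamp_facts (((Q₂ : ℝ) - |(l : ℝ)|) / ((Q₂ : ℝ) - Q₁)) 0).2.1, hχ l⟩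
    · obtain ⟨k, hk, rfl⟩ := Finset.mem_image.mp hn
      exact hW k hk

end Summit.AnomalousDissipation.AnomalousDissipation.Theorems.SawtoothPulseCascade.K1Window
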